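import Literature.NumberTheory.Automorphic.HermitianLatticeTreeParent       -- ★ (T1-D) parents in a frame
import Literature.Combinatorics.SimpleGraph.TreeRootedCriterionFixedSubtree   -- ★ `RootedTree.isTree_of_parent`
import HarnessLib

/-!
# THE LATTICE GRAPH OF A UNIMODULAR HERMITIAN PLANE OVER A DISCRETELY VALUED FIELD IS A TREE
# (Bruhat–Tits 1972 §10: the building of a rank-one unitary group; Serre, *Trees*, II.1.1; Kottwitz 1988 §2)

Topic `NumberTheory/Automorphic`; namespace `Literature.NumberTheory.Automorphic.HermitianLatticeTree`.  THEOREMS ONLY (no definition, no instance, no notation, no named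
fact, no `sorry`).  Part (T1-E), the HEAD of the lattice-tree road.  Cell `pub/hodgecm-mathlib` (D-0151), crux H413 (stmt-HodgeConjecture-24833), line «N6nsGerm», the Euler–Poincaré road (R2) `stub_N6nsR2EP : RankOneEulerPoincareNonsplit` — a count-free proof of the ELLIPTIC relation (E) of ★ `Rogawski1990/RankOneEulerPoincareGlue` at every TAME non-split place, inert and ramified alike (A-p17 (g22) bytes (T1), co-hand A-p06 (g27) `F0/P3a/A-p06/g27/CENSUS-R2ram-RamifiedEulerPoincare.A-p06g27.md`, LEAD F0P3a-plan (g10) WORDS T9-6 ∕ T9-8).  At every TAME non-split place `w` the bipartite graph `latticeTree σ ϖ_w H` (self-dual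
⊔ `ϖ_w`-modular lattices, `ϖL ≤ Λ ≤ L`) is the Bruhat–Tits tree of `U(H)(F_w)` (inert `w`: vertices of the two types = `U/K ⊔ U/K′`, edges = `U/I`) or its barycentric
subdivision (tame ramified `w`), so that the ELLIPTIC relation (E) `#Fix(U/K) + #Fix(U/K′) = #Fix(U/I) + 1` is the Euler count of the (finite, non-empty) fixed subtree of
an elliptic regular `γ` (★ `TreeRootedCriterionFixedSubtree`: `ncard_fixedPoints_eq_ncard_fixedEdges_add_one`, `exists_fixedPoint_of_finite_invariant`, fed with
`latticeTreeIso` ∕ `latticeTreeColoring` of ★ `HermitianLatticeTreeDefs`).  HONEST LABEL: HC_CM is proved only modulo the printed citations until rung 0 closes; nothing printed is asserted here (elementary lattice algebra over a valuation ring).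

* `isSelfDualLattice_latt_one` (the root `L₀ = 𝒪²`), `eq_latt_one_of_isSelfDualLattice_of_latticeDepth_eq_zero`, **`latticeParent_spec`** (frame-free: the parent of a
  special `M ≠ L₀` is special of the other type, adjacent, one level up), `scaleLattice_zpow_latticeDepth_le`, **`eq_latticeParent_of_adj`** (KEY: every edge is a
  parent edge — by (D1)–(D4), `depth L ≤ depth Λ ≤ depth L + 1` along an edge), **`isTree_latticeTree`** (via ★ `RootedTree.isTree_of_parent` with the level function
  `2·depth` ∕ `2·depth − 1`).

## References
* [Serre1980Trees] J.-P. Serre, *Trees* (1980), Ch. II §1.1 (the tree of `SL₂` over a local field: lattices, adjacency, distance from a base lattice).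
* [Jacobowitz1962] R. Jacobowitz, *Hermitian forms over local fields*, Amer. J. Math. 84 (1962), §4, §7–§8 (unimodular and `𝔭`-modular hermitian lattices).
* [BruhatTits1972] F. Bruhat, J. Tits, *Groupes réductifs sur un corps local I*, Publ. IHÉS 41 (1972), §10 (the building of a rank-one group is a tree).
* [Kottwitz1988] R. E. Kottwitz, *Tamagawa numbers*, Ann. of Math. 127 (1988), §2 (facets of the building and the Euler–Poincaré function).
-/

set_option autoImplicit false

noncomputable section

open scoped ValuativeRel Matrix MatrixGroups
open Matrix ValuativeRel Literature.Combinatorics.SimpleGraph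

namespace Literature.NumberTheory.Automorphic.HermitianLatticeTree

variable {E : Type*} [Field E] [ValuativeRel E]

/-! ## §9 The KEY lemma «every edge is a parent edge» and the tree -/

section Tree

variable (σ : E →+* E) (hσv : ∀ x : E, valuation E (σ x) = valuation E x) {ϖ : E} (hϖ : IsUniformizingElement ϖ)
  {H : Matrix (Fin 2) (Fin 2) E} (hH : IsUnimodular₂ H) [IsDiscreteValuationRing 𝒪[E]]

omit [IsDiscreteValuationRing 𝒪[E]] in
include hH in
/-- The root `L₀ = latt 1 = 𝒪²` is self-dual (its Gram matrix is `H`). [cite: Jacobowitz1962, §7] -/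
theorem isSelfDualLattice_latt_one : IsSelfDualLattice σ H (latt (1 : Matrix (Fin 2) (Fin 2) E)) :=
  ⟨1, by rw [Units.val_one], by simpa [formCongr, Matrix.map_one σ (map_zero σ) (map_one σ)] using hH⟩

include hσv hϖ hH in
/-- A self-dual lattice of depth `0` is the root. [cite: Serre1980Trees, II.1.1] -/
theorem eq_latt_one_of_isSelfDualLattice_of_latticeDepth_eq_zero {M : Submodule 𝒪[E] (Fin 2 → E)} (hM : IsSelfDualLattice σ H M)
    (h0 : latticeDepth ϖ M = 0) : M = latt (1 : Matrix (Fin 2) (Fin 2) E) := by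
  obtain ⟨g, rfl, -⟩ := id hM
  obtain ⟨P, hP, a, b, hfr⟩ := exists_frame hϖ g
  rw [hfr] at hM h0 ⊢
  have hab := ((isSelfDualLattice_frame_iff σ hσv hϖ hH P hP a b).1 hM).1
  rw [latticeDepth_latt_mul_diagonal hϖ P hP] at h0
  have ha : a = 0 := by have := Int.toNat_eq_zero.1 h0; omega
  have hb : b = 0 := by omega
  subst ha; subst hb
  exact (latt_one_eq_latt_mul_diagonal_zero P hP).symm

include hσv hϖ hH in
/-- **PARENT OF A SPECIAL LATTICE** (frame-free summary): for a special `M ≠ L₀`, `latticeParent M` is special OF THE OTHER TYPE, adjacent to `M` in the tree, and one level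
closer to the root: `2·depth(parent) − [parent modular] + 1 = 2·depth(M) − [M modular]`. [cite: Serre1980Trees, II.1.1] [cite: BruhatTits1972, §10] -/
theorem latticeParent_spec {M : Submodule 𝒪[E] (Fin 2 → E)} (hM : IsSpecialLattice σ ϖ H M) (hM0 : M ≠ latt (1 : Matrix (Fin 2) (Fin 2) E)) :
    (IsSelfDualLattice σ H M → IsModularLattice σ ϖ H (latticeParent σ ϖ H M) ∧ scaleLattice ϖ M ≤ latticeParent σ ϖ H M ∧ latticeParent σ ϖ H M ≤ M ∧
        latticeDepth ϖ (latticeParent σ ϖ H M) = latticeDepth ϖ M ∧ 1 ≤ latticeDepth ϖ M) ∧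
    (IsModularLattice σ ϖ H M → IsSelfDualLattice σ H (latticeParent σ ϖ H M) ∧ scaleLattice ϖ (latticeParent σ ϖ H M) ≤ M ∧ M ≤ latticeParent σ ϖ H M ∧
        latticeDepth ϖ (latticeParent σ ϖ H M) + 1 = latticeDepth ϖ M ∧ 1 ≤ latticeDepth ϖ M) := by
  have hg : ∃ g : GL (Fin 2) E, M = latt (g : Matrix (Fin 2) (Fin 2) E) := by
    rcases hM with ⟨g, hg, -⟩ | ⟨g, hg, -⟩ <;> exact ⟨g, hg⟩
  obtain ⟨g, rfl⟩ := hg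
  obtain ⟨P, hP, a, b, hfr⟩ := exists_frame hϖ g
  rw [hfr] at hM hM0 ⊢
  constructor
  · intro hsd
    have hab := ((isSelfDualLattice_frame_iff σ hσv hϖ hH P hP a b).1 hsd).1
    have hk : 1 ≤ max a b := by
      by_contra hlt
      have ha : a = 0 := by omega
      have hb : b = 0 := by omega
      subst ha; subst hb
      exact hM0 (latt_one_eq_latt_mul_diagonal_zero P hP).symm
    obtain ⟨hpar, hmod, h1, h2, hdep⟩ := latticeParent_of_isSelfDualLattice σ hσv hϖ hH P hP hsd hk
    rw [hpar]
    refine ⟨hmod, h1, h2, ?_, ?_⟩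
    · have h3 := latticeDepth_frame_cast hϖ P hP (show 0 ≤ max a b by omega)
      omega
    · have h3 := latticeDepth_frame_cast hϖ P hP (show 0 ≤ max a b by omega)
      omega
  · intro hmd
    have hab := ((isModularLattice_frame_iff σ hσv hϖ hH P hP a b).1 hmd).1
    obtain ⟨hpar, hsd, h1, h2, hdep⟩ := latticeParent_of_isModularLattice σ hσv hϖ hH P hP hmd
    rw [hpar]
    refine ⟨hsd, h1, h2, ?_, ?_⟩
    · have h3 := latticeDepth_frame_cast hϖ P hP (show 0 ≤ max a b by omega)
      omega
    · have h3 := latticeDepth_frame_cast hϖ P hP (show 0 ≤ max a b by omega)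
      omega

omit [IsDiscreteValuationRing 𝒪[E]] in
include hϖ in
/-- `ϖ^{depth M} L₀ ≤ M` for a framed lattice: the depth is attained. [cite: Serre1980Trees, II.1.1] -/
theorem scaleLattice_zpow_latticeDepth_le (P : GL (Fin 2) E) (hP : P ∈ glInt 2 E) (a b : ℤ) (k : ℕ)
    (hk : latticeDepth ϖ (latt ((P : Matrix (Fin 2) (Fin 2) E) * Matrix.diagonal ![ϖ ^ a, ϖ ^ b])) = k) :
    scaleLattice (ϖ ^ (k : ℤ)) (latt (1 : Matrix (Fin 2) (Fin 2) E)) ≤ latt ((P : Matrix (Fin 2) (Fin 2) E) * Matrix.diagonal ![ϖ ^ a, ϖ ^ b]) := by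
  rw [scaleLattice_zpow_latt_one_le_iff hϖ P hP, ← hk, latticeDepth_latt_mul_diagonal hϖ P hP]
  constructor
  · exact (le_max_left a b).trans (Int.self_le_toNat _)
  · exact (le_max_right a b).trans (Int.self_le_toNat _)

include hσv hϖ hH in
/-- **THE KEY LEMMA «EVERY EDGE IS A PARENT EDGE»**: if `M` is self-dual, `N` is `ϖ`-modular and `ϖM ≤ N ≤ M`, then `N = latticeParent M` (and `M ≠ L₀`) or
`M = latticeParent N` — by the duality facts (D1)–(D4) and the depth bounds `depth M ≤ depth N ≤ depth M + 1`. [cite: Serre1980Trees, II.1.1] [cite: BruhatTits1972, §10] -/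
theorem eq_latticeParent_of_adj {M N : Submodule 𝒪[E] (Fin 2 → E)} (hM : IsSelfDualLattice σ H M) (hN : IsModularLattice σ ϖ H N)
    (h1 : scaleLattice ϖ M ≤ N) (h2 : N ≤ M) :
    (M ≠ latt (1 : Matrix (Fin 2) (Fin 2) E) ∧ N = latticeParent σ ϖ H M) ∨ M = latticeParent σ ϖ H N := by
  -- frames and depths
  obtain ⟨g, rfl, -⟩ := id hM
  obtain ⟨g', rfl, -⟩ := id hN
  obtain ⟨P, hP, a, b, hfr⟩ := exists_frame hϖ g
  obtain ⟨P', hP', a', b', hfr'⟩ := exists_frame hϖ g'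
  rw [hfr] at hM h1 h2 ⊢
  rw [hfr'] at hN h1 h2 ⊢
  have hab := ((isSelfDualLattice_frame_iff σ hσv hϖ hH P hP a b).1 hM).1
  have hab' := ((isModularLattice_frame_iff σ hσv hϖ hH P' hP' a' b').1 hN).1
  have hkM := latticeDepth_frame_cast hϖ P hP (show 0 ≤ max a b by omega)
  have hkN := latticeDepth_frame_cast hϖ P' hP' (show 0 ≤ max a' b' by omega)
  -- `ϖ^{k′} L₀ ≤ N ≤ M` ⇒ `k ≤ k′`;  `ϖ^{k+1} L₀ ≤ ϖM ≤ N` ⇒ `k′ ≤ k + 1`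
  have hattN := scaleLattice_zpow_latticeDepth_le hϖ P' hP' a' b' _ rfl
  have hattM := scaleLattice_zpow_latticeDepth_le hϖ P hP a b _ rfl
  have hle1 : max a b ≤ max a' b' := by
    have h := (scaleLattice_zpow_latt_one_le_iff hϖ P hP a b _).1 (hattN.trans h2)
    rw [hkN] at h; omega
  have hle2 : max a' b' ≤ max a b + 1 := by
    have hϖM : scaleLattice (ϖ ^ (max a b + 1)) (latt (1 : Matrix (Fin 2) (Fin 2) E)) ≤
        scaleLattice ϖ (latt ((P : Matrix (Fin 2) (Fin 2) E) * Matrix.diagonal ![ϖ ^ a, ϖ ^ b])) := by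
      rw [scaleLattice_uniformizer_latt_mul_diagonal hϖ, scaleLattice_zpow_latt_one_le_iff hϖ P hP]; omega
    have h := (scaleLattice_zpow_latt_one_le_iff hϖ P' hP' a' b' _).1 (hϖM.trans h1)
    omega
  rcases (show max a' b' = max a b + 1 ∨ max a' b' = max a b by omega) with hcase | hcase
  · -- `N` is deeper: `M = parent N = ϖ⁻¹N ⊓ ϖ^{-k} L₀` by (D3) and (D1)
    right
    have hnsd : ¬ IsSelfDualLattice σ H (latt ((P' : Matrix (Fin 2) (Fin 2) E) * Matrix.diagonal ![ϖ ^ a', ϖ ^ b'])) :=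
      fun h => not_isModularLattice_of_isSelfDualLattice σ hσv hϖ H h hN
    have hQ := (latticeParent_of_isModularLattice σ hσv hϖ hH P' hP' hN).2.1
    have hMle : latt ((P : Matrix (Fin 2) (Fin 2) E) * Matrix.diagonal ![ϖ ^ a, ϖ ^ b]) ≤
        latticeParent σ ϖ H (latt ((P' : Matrix (Fin 2) (Fin 2) E) * Matrix.diagonal ![ϖ ^ a', ϖ ^ b'])) := by
      rw [latticeParent, if_neg hnsd, hkN]
      refine le_inf ((scaleLattice_le_iff_le_scaleLattice_inv hϖ.ne_zero _ _).1 h1) ?_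
      have h := le_scaleLattice_of_isSelfDualLattice σ hσv hϖ hH hM _ hattM
      rw [hkM] at h
      rwa [show (1 : ℤ) - max a' b' = -max a b by omega]
    rw [(latticeParent_of_isModularLattice σ hσv hϖ hH P' hP' hN).1] at hMle ⊢
    exact eq_of_le_of_isSelfDualLattice σ hσv hM hQ hMle
  · -- same depth: `N = parent M = M ⊓ ϖ^{1-k} L₀` by (D4) and (D2); and `M ≠ L₀` since `k = k′ ≥ 1`
    left
    have hk : 1 ≤ max a b := by omega
    refine ⟨fun h0 => ?_, ?_⟩
    · have := congrArg (latticeDepth ϖ) h0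
      rw [show latt (1 : Matrix (Fin 2) (Fin 2) E) = latt ((P : Matrix (Fin 2) (Fin 2) E) * Matrix.diagonal ![ϖ ^ (0 : ℤ), ϖ ^ (0 : ℤ)]) from
        latt_one_eq_latt_mul_diagonal_zero P hP, latticeDepth_latt_mul_diagonal hϖ P hP, latticeDepth_latt_mul_diagonal hϖ P hP] at this
      simp at this; omega
    · have hR := (latticeParent_of_isSelfDualLattice σ hσv hϖ hH P hP hM hk).2.1
      have hNle : latt ((P' : Matrix (Fin 2) (Fin 2) E) * Matrix.diagonal ![ϖ ^ a', ϖ ^ b']) ≤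
          latticeParent σ ϖ H (latt ((P : Matrix (Fin 2) (Fin 2) E) * Matrix.diagonal ![ϖ ^ a, ϖ ^ b])) := by
        rw [latticeParent, if_pos hM, hkM]
        refine le_inf h2 ?_
        have h := le_scaleLattice_of_isModularLattice σ hσv hϖ hH hN _ hattN
        rw [hkN, hcase] at h
        exact h
      rw [(latticeParent_of_isSelfDualLattice σ hσv hϖ hH P hP hM hk).1] at hNle ⊢
      exact eq_of_le_of_isModularLattice σ hσv hN hR hNle

include hσv hϖ hH in
/-- **THE LATTICE GRAPH OF A UNIMODULAR HERMITIAN PLANE IS A TREE** (Bruhat–Tits; here from the rooted criterion ★ `isTree_of_parent` with root `L₀ = 𝒪²`,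
depth `2·depth − [modular]` and `latticeParent`). [cite: BruhatTits1972, §10] [cite: Serre1980Trees, II.1.1] -/
theorem isTree_latticeTree : (latticeTree σ ϖ H).IsTree := by
  classical
  let V := {M : Submodule 𝒪[E] (Fin 2 → E) // IsSpecialLattice σ ϖ H M}
  let r : V := ⟨latt (1 : Matrix (Fin 2) (Fin 2) E), Or.inl (isSelfDualLattice_latt_one σ hH)⟩
  let d : V → ℕ := fun v => if IsSelfDualLattice σ H v.1 then 2 * latticeDepth ϖ v.1 else 2 * latticeDepth ϖ v.1 - 1
  let p : V → V := fun v => if hv : IsSpecialLattice σ ϖ H (latticeParent σ ϖ H v.1) then ⟨latticeParent σ ϖ H v.1, hv⟩ else v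
  have hpval : ∀ v : V, v ≠ r → (p v).1 = latticeParent σ ϖ H v.1 ∧ (latticeTree σ ϖ H).Adj v (p v) ∧ d (p v) + 1 = d v := by
    intro v hv
    have hv0 : v.1 ≠ latt (1 : Matrix (Fin 2) (Fin 2) E) := fun h => hv (Subtype.ext h)
    obtain ⟨hS, hMd⟩ := latticeParent_spec σ hσv hϖ hH v.2 hv0
    rcases v.2 with hsd | hmd
    · obtain ⟨hmod, h1, h2, hdep, hk⟩ := hS hsd
      have hsp : IsSpecialLattice σ ϖ H (latticeParent σ ϖ H v.1) := Or.inr hmod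
      have hpv : p v = ⟨latticeParent σ ϖ H v.1, hsp⟩ := dif_pos hsp
      have hnsd : ¬ IsSelfDualLattice σ H (latticeParent σ ϖ H v.1) := fun h => not_isModularLattice_of_isSelfDualLattice σ hσv hϖ H h hmod
      refine ⟨by rw [hpv], ?_, ?_⟩
      · rw [hpv, latticeTree_adj_iff]
        refine ⟨fun h => hnsd ?_, Or.inl ⟨hsd, hmod, h1, h2⟩⟩
        have hv' : latticeParent σ ϖ H v.1 = v.1 := by have := congrArg Subtype.val h; exact this.symm
        rw [hv']; exact hsd
      · simp only [d, hpv, if_pos hsd, if_neg hnsd, hdep]; omega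
    · obtain ⟨hsd', h1, h2, hdep, hk⟩ := hMd hmd
      have hsp : IsSpecialLattice σ ϖ H (latticeParent σ ϖ H v.1) := Or.inl hsd'
      have hpv : p v = ⟨latticeParent σ ϖ H v.1, hsp⟩ := dif_pos hsp
      have hnsd : ¬ IsSelfDualLattice σ H v.1 := fun h => not_isModularLattice_of_isSelfDualLattice σ hσv hϖ H h hmd
      refine ⟨by rw [hpv], ?_, ?_⟩
      · rw [hpv, latticeTree_adj_iff]
        refine ⟨fun h => hnsd ?_, Or.inr ⟨hsd', hmd, h1, h2⟩⟩
        have hv' : v.1 = latticeParent σ ϖ H v.1 := by have := congrArg Subtype.val h; exact this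
        rw [hv']; exact hsd'
      · simp only [d, hpv, if_pos hsd', if_neg hnsd]; omega
  refine RootedTree.isTree_of_parent r d p (fun v hv => (hpval v hv).2) ?_
  -- every edge is a parent edge (KEY)
  intro v w hvw
  rw [latticeTree_adj_iff] at hvw
  obtain ⟨hne, h⟩ := hvw
  rcases h with ⟨hsd, hmod, h1, h2⟩ | ⟨hsd, hmod, h1, h2⟩
  · rcases eq_latticeParent_of_adj σ hσv hϖ hH hsd hmod h1 h2 with ⟨hv0, hpar⟩ | hpar
    · left
      have hv : v ≠ r := fun h => hv0 (congrArg Subtype.val h)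
      exact ⟨hv, Subtype.ext (by rw [(hpval v hv).1]; exact hpar.symm)⟩
    · right
      have hw : w ≠ r := by
        intro h
        have := isSelfDualLattice_latt_one σ hH
        rw [← show w.1 = latt 1 from congrArg Subtype.val h] at this
        exact not_isModularLattice_of_isSelfDualLattice σ hσv hϖ H this hmod
      exact ⟨hw, Subtype.ext (by rw [(hpval w hw).1]; exact hpar.symm)⟩
  · rcases eq_latticeParent_of_adj σ hσv hϖ hH hsd hmod h1 h2 with ⟨hw0, hpar⟩ | hpar
    · right
      have hw : w ≠ r := fun h => hw0 (congrArg Subtype.val h)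
      exact ⟨hw, Subtype.ext (by rw [(hpval w hw).1]; exact hpar.symm)⟩
    · left
      have hv : v ≠ r := by
        intro h
        have := isSelfDualLattice_latt_one σ hH
        rw [← show v.1 = latt 1 from congrArg Subtype.val h] at this
        exact not_isModularLattice_of_isSelfDualLattice σ hσv hϖ H this hmod
      exact ⟨hv, Subtype.ext (by rw [(hpval v hv).1]; exact hpar.symm)⟩

end Tree

end Literature.NumberTheory.Automorphic.HermitianLatticeTree

end
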